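import Summits.CriticalPhenomena.SAWScalingLimit.Theses.SAWQuarterTwist

/-!
# Line `gauge-liouville` — registered skeleton for the crux `TwistedPropagatorLaw` (stmt-CriticalPhenomena-16650)

Crux (FIXED; rank 2 of `route-CriticalPhenomena-SAWQuarterTwist`): the WHOLE-PLANE QUARTER-TWISTED PROPAGATOR LAW —
`∃ α > 0, ∃ C ≠ 0` such that for every admissible exhaustion `(Λ_s, x_s)` of the plane and every `ψ ∈ C_c(ℂ ∖ 0)`,
`T_s(ψ) := s^{α-2} Σ_e ψ((m_e − triEmbed x_s)/s) F^tw_s(e) → C ∫ ψ(w)|w|^{-α} e^{-iαθ(w)} dw` (`θ` = angle from the cut).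

## The cut: tightness → subsequential limits → gauge monodromy + Liouville → amplitude

This line does NOT assume a universal limit (the hard stub of `Lines/birth.lean`). It runs the classical
"precompactness / identification / uniqueness" architecture, and identifies subsequential limits by the ONE exact
structure the quarter twist adds to the Duminil-Copin–Smirnov observable: its `ℤ₄` GAUGE COVARIANCE. The twisted
observable is a section of a flat line bundle with holonomy a fourth root of unity around the source hexagon; the
crux's `F^tw` is its trivialisation along the `0°` ray (cut₁), and the same section trivialised along the `60°` ray
(cut₂: the edges crossed by the ray from the source hexagon centre through the centre of the hexagon `x + e₁`) is
`F^tw,2`. EXACTLY (finite combinatorics, stub `stub_gauge`, provable now): `F^tw,2(e) = u · F^tw(e)` for mid-edges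
`e` strictly inside the open sector `0° < θ < 60°`, `F^tw,2(e) = F^tw(e)` strictly outside the closed sector,
with ONE constant `u`, `u⁴ = 1` (enumeration in this unit: `u = −i`). Consequently any subsequential scaling
limit `f` of `F^tw` (holomorphic off cut₁, stub `stub_holomorphic` for gauge 1) continues across cut₁ as the
limit `g` of `F^tw,2` (holomorphic off cut₂, the same stub for gauge 2): `f` has UNIMODULAR MONODROMY `u`
around `0`. A holomorphic function on `ℂ ∖ 0` with unimodular monodromy and SCALE-INVARIANT annulus bounds
`|∫ φ(c·) f| ≤ M c^{α-2}` for `φ ∈ C_c(A)`, `|φ| ≤ 1`, all `c > 0` (i.e. `∫_{r<|w|<2r}|f| ≲ r^{2-α}` at ALL scales) is `C·w^{-α}` (Liouville on the Laurent expansion of `w^{-β} f`,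
`e^{2πiβ} = u`; stub `stub_liouville`, classical, provable now) — NO dilation covariance and NO universality over
exhaustions is needed for the SHAPE. The scale-invariant bounds come from tightness (stub `stub_tight`: two-sided
eventual bounds at ONE exponent `α`, uniform over admissible exhaustions — exactly what the crux implies for its
`α`, and what pins `α` two-sidedly) transported to every scale by the exact rescaling identity
`T[Λ,x](φ(·/r), s) = r^{2-α} T[Λ(·/r), x(·/r)](φ, rs)`. Subsequential limits exist by vague compactness
(stub `stub_compact`, classical: Banach–Steinhaus + Banach–Alaoglu on `C₀` of annuli, diagonal over an
exhausting sequence). What remains is the AMPLITUDE: stub `stub_amplitude` — two subsequential limits of the form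
`C_i · w^{-α}` (possibly along different exhaustions) have `C₁ = C₂` (existence of the lattice amplitude and its
insensitivity to the far domain; open). The glue `TwistedPropagatorLaw_of` (kernel-checked, no `sorry` of its own)
assembles: tightness ⇒ bounded sequences ⇒ joint subsequence for both gauges ⇒ densities `f, g` ⇒ gauge
identities pass to the limit ⇒ Liouville ⇒ `Φ = C_Φ · profileIntegral` ⇒ all `C_Φ` equal to the reference
amplitude `C* ≠ 0` (non-degeneracy clause of tightness) ⇒ convergence along `atTop` by the subsequence principle
(`Filter.tendsto_of_subseq_tendsto`). Vacuity: if no admissible exhaustion exists the crux is vacuous (`by_cases`).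

Stubs (6): `stub_tight` (HARDEST, open), `stub_compact` (classical), `stub_holomorphic` (open: the half
Cauchy–Riemann exposure — orientation coherence of the three mid-edge classes + no mass on the cut, in each gauge),
`stub_gauge` (lattice, provable now), `stub_liouville` (classical), `stub_amplitude` (open).
Vocabulary §1 = the crux's `let`s verbatim (as in `Lines/birth.lean` §1, same names, so that
`twistedPropagatorLaw_iff` is `Iff.rfl`) + the second gauge.
-/

noncomputable section

open scoped BigOperators Topology Manifold Classical MeasureTheory ProbabilityTheory Matrix InnerProductSpace ComplexConjugate ContinuousMap
open Filter Set Function TopologicalSpace MeasureTheory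
open Literature.Probability.RandomPlanarGeometry Literature.Probability.LatticeModels

namespace Summit.CriticalPhenomena.SAWScalingLimit.Cruxes.TwistedPropagatorLaw.GaugeLiouville

-- BEGIN VOCABULARY
/-! ### 1. Vocabulary — the crux's `let`s as definitions (verbatim `Lines/birth.lean` §1) and the second gauge -/

/-- Crossing sign of the step `p → q` relative to cut₁ (the `0°` ray of the cell `x₀`): `+1` upward, `−1`
downward, `0` otherwise. VERBATIM the crux's `let sgn`. -/
def cutSign (x₀ : Site 2) (p q : HexVertex) : ℤ :=
  if q.2 = 0 ∧ p.2 = 1 ∧ p.1 = q.1 - Pi.single 1 1 ∧ q.1 1 = x₀ 1 ∧ x₀ 0 ≤ q.1 0 then 1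
  else if p.2 = 0 ∧ q.2 = 1 ∧ q.1 = p.1 - Pi.single 1 1 ∧ p.1 1 = x₀ 1 ∧ x₀ 0 ≤ p.1 0 then -1 else 0

/-- Crossing sign of the step `p → q` relative to cut₂ (the `60°` ray of the cell `x₀`, crossing the edges
`{(c,0),(c-e₀,1)}`, `c 0 = x₀ 0`, `x₀ 1 ≤ c 1`): `+1` counterclockwise (`(c,0) → (c-e₀,1)`), `−1` clockwise. -/
def cutSign₂ (x₀ : Site 2) (p q : HexVertex) : ℤ :=
  if p.2 = 0 ∧ q.2 = 1 ∧ q.1 = p.1 - Pi.single 0 1 ∧ p.1 0 = x₀ 0 ∧ x₀ 1 ≤ p.1 1 then 1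
  else if q.2 = 0 ∧ p.2 = 1 ∧ p.1 = q.1 - Pi.single 0 1 ∧ q.1 0 = x₀ 0 ∧ x₀ 1 ≤ q.1 1 then -1 else 0

/-- The source mid-edge (left vertical side of the hexagon of the cell `x₀`). VERBATIM the crux's `let a`. -/
def srcEdge (x₀ : Site 2) : Sym2 HexVertex :=
  s((x₀ - Pi.single 0 1, (0 : Fin 2)), (x₀ - Pi.single 0 1 - Pi.single 1 1, (1 : Fin 2)))

/-- Twist exponent `N(γ)` for cut₁. VERBATIM the crux. -/
def twistExp (x₀ : Site 2) {Λ : Finset HexVertex} {a z : Sym2 HexVertex}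
    (γ : SAW.HexMidEdgeSAW Λ a z) : ℤ :=
  ((γ.verts.zip γ.verts.tail).map (fun pq => cutSign x₀ pq.1 pq.2)).sum

/-- Twist exponent `N₂(γ)` for cut₂. -/
def twistExp₂ (x₀ : Site 2) {Λ : Finset HexVertex} {a z : Sym2 HexVertex}
    (γ : SAW.HexMidEdgeSAW Λ a z) : ℤ :=
  ((γ.verts.zip γ.verts.tail).map (fun pq => cutSign₂ x₀ pq.1 pq.2)).sum

/-- The quarter-twisted observable in gauge 1 (the crux's `let F`, VERBATIM). -/
def twObs (Λ : Finset HexVertex) (x₀ : Site 2) (z : Sym2 HexVertex) : ℂ :=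
  ∑ γ : SAW.HexMidEdgeSAW Λ (srcEdge x₀) z,
    γ.weight SAW.hexCriticalFugacity (5 / 8) * Complex.I ^ twistExp x₀ γ

/-- The same section in gauge 2 (cut along the `60°` ray). -/
def twObs₂ (Λ : Finset HexVertex) (x₀ : Site 2) (z : Sym2 HexVertex) : ℂ :=
  ∑ γ : SAW.HexMidEdgeSAW Λ (srcEdge x₀) z,
    γ.weight SAW.hexCriticalFugacity (5 / 8) * Complex.I ^ twistExp₂ x₀ γ

/-- Gauge-indexed observable: `false` = gauge 1 (the crux), `true` = gauge 2. -/
def twObsG : Bool → Finset HexVertex → Site 2 → Sym2 HexVertex → ℂ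
  | false => twObs
  | true => twObs₂

/-- Admissible whole-plane exhaustions. VERBATIM the crux's two hypotheses on `(Λ, x)`. -/
def IsPlaneExhaustion (Λ : ℝ → Finset HexVertex) (x : ℝ → Site 2) : Prop :=
  (∀ s, SAW.hexDomainSimplyConnected (Λ s)) ∧
    ∀ K : Set ℂ, IsCompact K → ∀ᶠ s : ℝ in Filter.atTop, ∀ v : HexVertex,
      (hexCenter v - triEmbed (x s)) / (s : ℂ) ∈ K → v ∈ Λ s

/-- Bulk test functions `ψ ∈ C_c(ℂ ∖ 0)`. VERBATIM the crux's three hypotheses on `ψ`. -/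
def TestFn (ψ : ℂ → ℂ) : Prop :=
  Continuous ψ ∧ HasCompactSupport ψ ∧ tsupport ψ ⊆ {(0 : ℂ)}ᶜ

/-- The smeared, power-normalised, rescaled twisted observable (gauge 1). VERBATIM the crux. -/
def smeared (Λ : ℝ → Finset HexVertex) (x : ℝ → Site 2) (α : ℝ) (ψ : ℂ → ℂ) (s : ℝ) : ℂ :=
  (s : ℂ) ^ ((α : ℂ) - 2) *
    ∑ᶠ e ∈ SAW.hexDomainMidEdges (Λ s),
      ψ ((SAW.hexMidpoint e - triEmbed (x s)) / (s : ℂ)) * twObs (Λ s) (x s) e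

/-- The smeared observable in gauge `τ`. -/
def smearedG (τ : Bool) (Λ : ℝ → Finset HexVertex) (x : ℝ → Site 2) (α : ℝ) (ψ : ℂ → ℂ) (s : ℝ) : ℂ :=
  (s : ℂ) ^ ((α : ℂ) - 2) *
    ∑ᶠ e ∈ SAW.hexDomainMidEdges (Λ s),
      ψ ((SAW.hexMidpoint e - triEmbed (x s)) / (s : ℂ)) * twObsG τ (Λ s) (x s) e

/-- The pure-power profile paired with `ψ`. VERBATIM the crux's limit value without `C`. -/
def profileIntegral (α : ℝ) (ψ : ℂ → ℂ) : ℂ :=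
  ∫ w, ψ w * ((‖w‖ ^ (-α) : ℝ) : ℂ) *
    Complex.exp (-(Complex.I * (α : ℂ) * ((Complex.arg (-w) + Real.pi : ℝ) : ℂ)))

/-- `ℂ ∖ [0, ∞)`: the plane cut along the `0°` ray. -/
def slitRegion : Set ℂ := {w | -w ∈ Complex.slitPlane}

/-- `ℂ ∖ [0, ∞)·ζ`: the plane cut along the `60°` ray (`ζ = e^{iπ/3}`). -/
def slitRegion₂ : Set ℂ := {w | -(w * (starRingEnd ℂ) triZeta) ∈ Complex.slitPlane}

/-- Slit region of gauge `τ`. -/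
def slitG : Bool → Set ℂ
  | false => slitRegion
  | true => slitRegion₂

/-- The OPEN sector `0° < θ < 60°` between the two cuts (`w = a + bζ`, `a, b > 0`). -/
def sectorS : Set ℂ := {w | 0 < w.im ∧ (w * (starRingEnd ℂ) triZeta).im < 0}

/-- The open complement of the CLOSED sector (`θ ∈ (60°, 360°)`). -/
def sectorR : Set ℂ := {w | w.im < 0 ∨ 0 < (w * (starRingEnd ℂ) triZeta).im}

/-- The reference open annulus `1 < |w| < 2`. -/
def annulusA : Set ℂ := {w | 1 < ‖w‖ ∧ ‖w‖ < 2}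

/-! ### 2. The six statements of the line, named -/

/-- **T — tightness at one exponent, two-sided, uniform over admissible exhaustions.** -/
def Tight : Prop :=
  ∃ α : ℝ, 0 < α ∧
    (∀ (τ : Bool) (Λ : ℝ → Finset HexVertex) (x : ℝ → Site 2) (ψ : ℂ → ℂ),
        IsPlaneExhaustion Λ x → TestFn ψ → ∃ B : ℝ, ∀ᶠ s : ℝ in atTop, ‖smearedG τ Λ x α ψ s‖ ≤ B) ∧
    (∃ M : ℝ, ∀ (Λ : ℝ → Finset HexVertex) (x : ℝ → Site 2) (φ : ℂ → ℂ),
        IsPlaneExhaustion Λ x → TestFn φ → tsupport φ ⊆ annulusA → (∀ w, ‖φ w‖ ≤ 1) →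
          ∀ᶠ s : ℝ in atTop, ‖smeared Λ x α φ s‖ ≤ M) ∧
    (∃ m : ℝ, 0 < m ∧ ∃ ψ₀ : ℂ → ℂ, TestFn ψ₀ ∧
        ∀ (Λ : ℝ → Finset HexVertex) (x : ℝ → Site 2), IsPlaneExhaustion Λ x →
          ∀ᶠ s : ℝ in atTop, m ≤ ‖smeared Λ x α ψ₀ s‖)

/-- **K — vague sequential compactness of bounded families of smeared functionals (classical).** -/
def Compact : Prop :=
  ∀ (τ : Bool) (α : ℝ) (Λ : ℝ → Finset HexVertex) (x : ℝ → Site 2) (ns : ℕ → ℝ),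
    IsPlaneExhaustion Λ x → Tendsto ns atTop atTop →
    (∀ ψ : ℂ → ℂ, TestFn ψ → ∃ B : ℝ, ∀ k, ‖smearedG τ Λ x α ψ (ns k)‖ ≤ B) →
    ∃ ms : ℕ → ℕ, StrictMono ms ∧ ∃ Φ : (ℂ → ℂ) → ℂ, ∀ ψ : ℂ → ℂ, TestFn ψ →
      Tendsto (fun k => smearedG τ Λ x α ψ (ns (ms k))) atTop (𝓝 (Φ ψ))

/-- **H — subsequential limits have a locally integrable density, holomorphic off the cut of their gauge.** -/
def Holomorphic : Prop :=
  ∀ (τ : Bool) (α : ℝ), 0 < α → ∀ (Λ : ℝ → Finset HexVertex) (x : ℝ → Site 2) (ns : ℕ → ℝ)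
    (Φ : (ℂ → ℂ) → ℂ), IsPlaneExhaustion Λ x → Tendsto ns atTop atTop →
    (∀ ψ : ℂ → ℂ, TestFn ψ → Tendsto (fun k => smearedG τ Λ x α ψ (ns k)) atTop (𝓝 (Φ ψ))) →
    ∃ f : ℂ → ℂ, DifferentiableOn ℂ f (slitG τ) ∧ LocallyIntegrableOn f {(0 : ℂ)}ᶜ volume ∧
      ∀ ψ : ℂ → ℂ, TestFn ψ → Φ ψ = ∫ w, ψ w * f w

/-- **G — exact ℤ₄ gauge covariance (finite combinatorics, provable now).** -/
def Gauge : Prop :=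
  ∃ u : ℂ, u ^ 4 = 1 ∧ ∀ (Λ : Finset HexVertex) (x₀ : Site 2) (e : Sym2 HexVertex),
    e ∈ SAW.hexDomainMidEdges Λ →
      (SAW.hexMidpoint e - triEmbed x₀ ∈ sectorS → twObs₂ Λ x₀ e = u * twObs Λ x₀ e) ∧
      (SAW.hexMidpoint e - triEmbed x₀ ∈ sectorR → twObs₂ Λ x₀ e = twObs Λ x₀ e)

/-- **L — Liouville rigidity under unimodular monodromy (classical, provable now).** -/
def Liouville : Prop :=
  ∀ (α : ℝ), 0 < α → ∀ (f g : ℂ → ℂ) (u : ℂ), u ^ 4 = 1 →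
    DifferentiableOn ℂ f slitRegion → LocallyIntegrableOn f {(0 : ℂ)}ᶜ volume →
    DifferentiableOn ℂ g slitRegion₂ → LocallyIntegrableOn g {(0 : ℂ)}ᶜ volume →
    (∀ ψ : ℂ → ℂ, TestFn ψ → tsupport ψ ⊆ sectorS → ∫ w, ψ w * g w = u * ∫ w, ψ w * f w) →
    (∀ ψ : ℂ → ℂ, TestFn ψ → tsupport ψ ⊆ sectorR → ∫ w, ψ w * g w = ∫ w, ψ w * f w) →
    (∃ M : ℝ, ∀ c : ℝ, 0 < c → ∀ φ : ℂ → ℂ, TestFn φ → tsupport φ ⊆ annulusA → (∀ w, ‖φ w‖ ≤ 1) →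
        ‖∫ w, φ ((c : ℂ) * w) * f w‖ ≤ M * c ^ (α - 2)) →
    ∃ C : ℂ, ∀ ψ : ℂ → ℂ, TestFn ψ → ∫ w, ψ w * f w = C * profileIntegral α ψ

/-- **A — amplitude uniqueness (open): two pure-power subsequential limits have the same amplitude.** -/
def Amplitude : Prop :=
  ∀ (α : ℝ), 0 < α → ∀ (Λ₁ : ℝ → Finset HexVertex) (x₁ : ℝ → Site 2) (Λ₂ : ℝ → Finset HexVertex)
    (x₂ : ℝ → Site 2) (ns₁ ns₂ : ℕ → ℝ) (C₁ C₂ : ℂ),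
    IsPlaneExhaustion Λ₁ x₁ → IsPlaneExhaustion Λ₂ x₂ → Tendsto ns₁ atTop atTop → Tendsto ns₂ atTop atTop →
    (∀ ψ : ℂ → ℂ, TestFn ψ →
        Tendsto (fun k => smeared Λ₁ x₁ α ψ (ns₁ k)) atTop (𝓝 (C₁ * profileIntegral α ψ))) →
    (∀ ψ : ℂ → ℂ, TestFn ψ →
        Tendsto (fun k => smeared Λ₂ x₂ α ψ (ns₂ k)) atTop (𝓝 (C₂ * profileIntegral α ψ))) →
    C₁ = C₂

/-- The crux with its three `let`s delta/zeta-reduced into the §1 vocabulary (definitionally the route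
decl, see `twistedPropagatorLaw_iff`). VERBATIM `Lines/birth.lean`. -/
def TwistedPropagatorLaw' : Prop :=
  ∃ (α : ℝ) (C : ℂ), 0 < α ∧ C ≠ 0 ∧
    ∀ (Λ : ℝ → Finset HexVertex) (x : ℝ → Site 2) (ψ : ℂ → ℂ),
      (∀ s, SAW.hexDomainSimplyConnected (Λ s)) →
      (∀ K : Set ℂ, IsCompact K → ∀ᶠ s : ℝ in Filter.atTop, ∀ v : HexVertex,
          (hexCenter v - triEmbed (x s)) / (s : ℂ) ∈ K → v ∈ Λ s) →
      Continuous ψ → HasCompactSupport ψ → tsupport ψ ⊆ {(0 : ℂ)}ᶜ →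
        Filter.Tendsto (smeared Λ x α ψ) Filter.atTop (nhds (C * profileIntegral α ψ))
-- END VOCABULARY

/-- The primed form IS the route decl. -/
theorem twistedPropagatorLaw_iff :
    TwistedPropagatorLaw' ↔
      Summit.CriticalPhenomena.SAWScalingLimit.Theses.SAWQuarterTwist.TwistedPropagatorLaw :=
  Iff.rfl

/-! ### 3. The registered stubs (the ONLY `sorry`s of this file) -/

/-- **T (HARDEST) — tightness.** There is ONE exponent `α > 0` such that, along every admissible exhaustion:
(i) for each gauge and each test function the smeared observable is eventually bounded; (ii) for test functions
supported in the reference annulus with `|φ| ≤ 1` the eventual bound is a constant `M` INDEPENDENT of the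
exhaustion (under the crux: `M = 2|C|∫_A |w|^{-α}`); (iii) non-degeneracy: some fixed `ψ₀` has
`|T_s(ψ₀)| ≥ m > 0` eventually, uniformly. (ii) failing for `α` above the true exponent and (iii) below it,
this pins the exponent two-sidedly. Why it might fail: (ii)+(iii) need control of an oscillatory sum with no
positivity (|F^tw| must be O(r^{-α}) on average although the untwisted two-point function is only o(1));
(i) for gauge 2 is not implied by the crux (values on the rays). Open. -/
theorem stub_tight : Tight := by
  sorry

/-- **K — vague compactness (classical).** Bounded sequences of the smeared functionals have subsequences
converging on every test function (Banach–Steinhaus on `C₀` of compact annuli, Riesz, Banach–Alaoglu for the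
separable predual, diagonal extraction over an exhausting sequence of annuli). -/
theorem stub_compact : Compact := by
  sorry

/-- **H — holomorphic density of subsequential limits, in each gauge (open: the half Cauchy–Riemann exposure).**
Mass bounds make the limit a Radon measure on `ℂ ∖ 0`; the exact vertex relation off the cut (route support item
`QuarterTwistRelation`, and its gauge-2 twin) gives `Φ(∂̄χ) = −Φ₂(∂χ)` with `Φ₂` the orientation-weighted
companion, so holomorphy off the cut (then Weyl) is the balance of the three mid-edge orientation classes; absence
of singular mass ON the cut and absolute continuity are the remaining content. -/
theorem stub_holomorphic : Holomorphic := by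
  sorry

/-- **G — exact gauge covariance (provable now).** For every finite `Λ`, cell `x₀` and genuine mid-edge `e`:
`F^tw,2(e) = u·F^tw(e)` if `m_e` lies in the open sector `0° < θ < 60°`, `F^tw,2(e) = F^tw(e)` if `m_e` lies
outside the closed sector, with one `u`, `u⁴ = 1`. Proof: for every lattice step `p → q`,
`cutSign − cutSign₂ = 1_S(q) − 1_S(p)` with `1_S(v) :⟺ x₀ 0 ≤ v.1 0 ∧ x₀ 1 ≤ v.1 1` (finite case analysis,
`omega`); telescope along `verts`; the first vertex (an endpoint of the source edge) is not in `S`; a genuine edge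
with midpoint in the open sector (resp. open complement) has both endpoints in `S` (resp. not in `S`). Hence
`N₂ = N − 1_S(last vertex)` walk by walk and `u = I⁻¹ = −I` (verified by enumeration in this unit). -/
theorem stub_gauge : Gauge := by
  sorry

/-- **L — Liouville rigidity (classical, provable now).** `g` continues `f` across the positive real axis with
the multiplicative jump `u`, `|u| = 1`, so `f` is a holomorphic function on the universal cover of `ℂ ∖ 0` with
unimodular monodromy: `f = w^{β} h(w)`, `e^{2πiβ} = u`, `h` single-valued holomorphic on `ℂ ∖ 0`; the annulus
bounds at ALL scales (`r → 0` and `r → ∞`), by the mean-value inequality for `|f|`, give `|h(w)| ≤ M'|w|^{-α-β}`,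
so every Laurent coefficient of `h` vanishes except possibly the one of index `−α−β` (if an integer): `f = c·w^{-α}`
on the slit region, i.e. `C|w|^{-α}e^{-iαθ(w)}` (branches differ by constants on the connected slit region); the
cut is Lebesgue-null. If the monodromy class of `u` does not match `α`, the conclusion holds with `C = 0`. -/
theorem stub_liouville : Liouville := by
  sorry

/-- **A — amplitude uniqueness (open).** If along two admissible exhaustions and two sequences of scales the
smeared observable converges to `C₁·profileIntegral α` and `C₂·profileIntegral α` on all test functions, then
`C₁ = C₂`: the lattice amplitude exists (no `s`-oscillation) and is insensitive to the far domain. Implied by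
the crux (for every `α > 0`); no mechanism is known (an exact normalising identity or a monotone quantity in
`s` would do). -/
theorem stub_amplitude : Amplitude := by
  sorry

/-! ### Name-keyed aliases (device of `Lines/birth.lean`: the skeleton audit admits hypotheses whose head
constant is named like a declared stub) -/
namespace __Registered
/-- Alias of `Tight`. -/ abbrev stub_tight : Prop := Tight
/-- Alias of `Compact`. -/ abbrev stub_compact : Prop := Compact
/-- Alias of `Holomorphic`. -/ abbrev stub_holomorphic : Prop := Holomorphic
/-- Alias of `Gauge`. -/ abbrev stub_gauge : Prop := Gauge
/-- Alias of `Liouville`. -/ abbrev stub_liouville : Prop := Liouville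
/-- Alias of `Amplitude`. -/ abbrev stub_amplitude : Prop := Amplitude
end __Registered

/-! ### 4. The sorry-free part: rescaling, boundedness, gauge bookkeeping, and the composition -/


/-- Gauge `false` is the crux's observable (definitionally). -/
theorem twObsG_false : twObsG false = twObs := rfl

/-- Gauge `true` is the second trivialisation (definitionally). -/
theorem twObsG_true : twObsG true = twObs₂ := rfl

/-- `smearedG false` IS the crux's smeared observable (definitionally). -/
theorem smearedG_false : smearedG false = smeared := rfl

/-- Dilating a test function by `c > 0` gives a test function. (VERBATIM `Lines/birth.lean`.) -/
theorem TestFn.dilate {ψ : ℂ → ℂ} (hψ : TestFn ψ) {c : ℝ} (hc : 0 < c) :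
    TestFn (fun w => ψ ((c : ℂ) * w)) := by
  have hc0 : (c : ℂ) ≠ 0 := Complex.ofReal_ne_zero.mpr hc.ne'
  refine ⟨hψ.1.comp (continuous_const_mul (c : ℂ)), ?_, ?_⟩
  · have h := hψ.2.1.comp_homeomorph (Homeomorph.mulLeft₀ (c : ℂ) hc0)
    rwa [Homeomorph.coe_mulLeft₀] at h
  · intro w hw
    rw [Set.mem_compl_singleton_iff]
    rintro rfl
    have h0 : ψ =ᶠ[𝓝 (0 : ℂ)] 0 :=
      notMem_tsupport_iff_eventuallyEq.mp (fun h => hψ.2.2 h rfl)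
    have ht : Filter.Tendsto (fun w : ℂ => (c : ℂ) * w) (𝓝 0) (𝓝 0) := by
      simpa only [mul_zero] using ((continuous_const_mul (c : ℂ)).tendsto (0 : ℂ))
    have h1 : (fun w => ψ ((c : ℂ) * w)) =ᶠ[𝓝 (0 : ℂ)] 0 :=
      (ht.eventually h0).mono fun w hw => by simpa using hw
    exact (notMem_tsupport_iff_eventuallyEq.mpr h1) hw

/-- Re-indexing an admissible exhaustion along `s ↦ c s` (`c > 0`) gives an admissible exhaustion.
(VERBATIM `Lines/birth.lean`.) -/
theorem IsPlaneExhaustion.rescale {Λ : ℝ → Finset HexVertex} {x : ℝ → Site 2}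
    (h : IsPlaneExhaustion Λ x) {c : ℝ} (hc : 0 < c) :
    IsPlaneExhaustion (fun s => Λ (c * s)) (fun s => x (c * s)) := by
  refine ⟨fun s => h.1 (c * s), fun K hK => ?_⟩
  have hcs : Filter.Tendsto (fun s : ℝ => c * s) Filter.atTop Filter.atTop :=
    Filter.tendsto_id.const_mul_atTop hc
  have hK' : IsCompact ((fun z : ℂ => z / (c : ℂ)) '' K) := hK.image (continuous_id.div_const _)
  filter_upwards [hcs.eventually (h.2 _ hK')] with s hs v hv
  refine hs v ⟨(hexCenter v - triEmbed (x (c * s))) / (s : ℂ), hv, ?_⟩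
  simp only [Complex.ofReal_mul]
  ring

/-- The exact rescaling identity: `T[Λ,x,α](ψ(c·), c s) = c^{α-2} · T[Λ(c·), x(c·), α](ψ, s)`.
(VERBATIM `Lines/birth.lean`.) -/
theorem smeared_rescale (Λ : ℝ → Finset HexVertex) (x : ℝ → Site 2) (α : ℝ) (ψ : ℂ → ℂ) {c s : ℝ}
    (hc : 0 < c) (hs : 0 < s) :
    smeared Λ x α (fun w => ψ ((c : ℂ) * w)) (c * s) =
      (c : ℂ) ^ ((α : ℂ) - 2) * smeared (fun s => Λ (c * s)) (fun s => x (c * s)) α ψ s := by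
  have hc0 : (c : ℂ) ≠ 0 := Complex.ofReal_ne_zero.mpr hc.ne'
  have hs0 : (s : ℂ) ≠ 0 := Complex.ofReal_ne_zero.mpr hs.ne'
  simp only [smeared, Complex.ofReal_mul]
  rw [Complex.mul_cpow_ofReal_nonneg hc.le hs.le, mul_assoc]
  congr 2
  refine finsum_congr fun e => finsum_congr fun _ => ?_
  congr 2
  field_simp

/-- An eventually bounded complex sequence is bounded. -/
theorem exists_bound_of_eventually {v : ℕ → ℂ} {B : ℝ} (h : ∀ᶠ k in atTop, ‖v k‖ ≤ B) :
    ∃ B' : ℝ, ∀ k, ‖v k‖ ≤ B' := by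
  obtain ⟨N, hN⟩ := eventually_atTop.1 h
  refine ⟨max B (∑ k ∈ Finset.range N, ‖v k‖), fun k => ?_⟩
  by_cases hk : N ≤ k
  · exact (hN k hk).trans (le_max_left _ _)
  · push Not at hk
    refine le_trans ?_ (le_max_right _ _)
    exact Finset.single_le_sum (f := fun k => ‖v k‖) (fun i _ => norm_nonneg _) (Finset.mem_range.2 hk)

private theorem pos_of_div_pos {a s : ℝ} (hs : 0 < s) (h : 0 < a / s) : 0 < a := by
  have := mul_pos h hs
  rwa [div_mul_cancel₀ _ hs.ne'] at this

private theorem neg_of_div_neg {a s : ℝ} (hs : 0 < s) (h : a / s < 0) : a < 0 := by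
  have := mul_neg_of_neg_of_pos h hs
  rwa [div_mul_cancel₀ _ hs.ne'] at this

private theorem im_div_real (w : ℂ) (s : ℝ) : (w / (s : ℂ)).im = w.im / s :=
  Complex.div_ofReal_im w s

private theorem im_div_real_mul (w ζ : ℂ) (s : ℝ) : (w / (s : ℂ) * ζ).im = (w * ζ).im / s := by
  rw [div_mul_eq_mul_div, Complex.div_ofReal_im]

/-- The sector is a cone: membership of `w / s` (`s > 0`) forces membership of `w`. -/
theorem mem_sectorS_of_div {w : ℂ} {s : ℝ} (hs : 0 < s) (h : w / (s : ℂ) ∈ sectorS) : w ∈ sectorS := by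
  obtain ⟨h1, h2⟩ := h
  rw [im_div_real] at h1
  rw [im_div_real_mul] at h2
  exact ⟨pos_of_div_pos hs h1, neg_of_div_neg hs h2⟩

/-- The complementary region is a cone too. -/
theorem mem_sectorR_of_div {w : ℂ} {s : ℝ} (hs : 0 < s) (h : w / (s : ℂ) ∈ sectorR) : w ∈ sectorR := by
  rcases h with h1 | h2
  · rw [im_div_real] at h1
    exact Or.inl (neg_of_div_neg hs h1)
  · rw [im_div_real_mul] at h2
    exact Or.inr (pos_of_div_pos hs h2)

/-- Gauge covariance at the smeared level, sector part: for test functions supported in the open sector,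
`T₂ = u · T₁` EXACTLY (term by term: off the support `ψ = 0`, on it the gauge identity). -/
theorem smearedG_true_of_sectorS {u : ℂ}
    (hG : ∀ (Λ : Finset HexVertex) (x₀ : Site 2) (e : Sym2 HexVertex), e ∈ SAW.hexDomainMidEdges Λ →
      (SAW.hexMidpoint e - triEmbed x₀ ∈ sectorS → twObs₂ Λ x₀ e = u * twObs Λ x₀ e) ∧
      (SAW.hexMidpoint e - triEmbed x₀ ∈ sectorR → twObs₂ Λ x₀ e = twObs Λ x₀ e))
    {ψ : ℂ → ℂ} (hψS : tsupport ψ ⊆ sectorS) (Λ : ℝ → Finset HexVertex) (x : ℝ → Site 2) (α : ℝ)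
    {s : ℝ} (hs : 0 < s) :
    smearedG true Λ x α ψ s = u * smeared Λ x α ψ s := by
  have key : (∑ᶠ e ∈ SAW.hexDomainMidEdges (Λ s),
      ψ ((SAW.hexMidpoint e - triEmbed (x s)) / (s : ℂ)) * twObs₂ (Λ s) (x s) e) =
      ∑ᶠ e ∈ SAW.hexDomainMidEdges (Λ s),
        u * (ψ ((SAW.hexMidpoint e - triEmbed (x s)) / (s : ℂ)) * twObs (Λ s) (x s) e) := by
    refine finsum_mem_congr rfl fun e he => ?_
    by_cases hmem : (SAW.hexMidpoint e - triEmbed (x s)) / (s : ℂ) ∈ tsupport ψ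
    · rw [((hG _ _ _ he).1 (mem_sectorS_of_div hs (hψS hmem)))]
      ring
    · rw [image_eq_zero_of_notMem_tsupport hmem]
      simp
  unfold smearedG smeared
  rw [twObsG_true, key, ← mul_finsum_mem]
  ring

/-- Gauge covariance at the smeared level, outer part: `T₂ = T₁` for test functions supported outside
the closed sector. -/
theorem smearedG_true_of_sectorR {u : ℂ}
    (hG : ∀ (Λ : Finset HexVertex) (x₀ : Site 2) (e : Sym2 HexVertex), e ∈ SAW.hexDomainMidEdges Λ →
      (SAW.hexMidpoint e - triEmbed x₀ ∈ sectorS → twObs₂ Λ x₀ e = u * twObs Λ x₀ e) ∧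
      (SAW.hexMidpoint e - triEmbed x₀ ∈ sectorR → twObs₂ Λ x₀ e = twObs Λ x₀ e))
    {ψ : ℂ → ℂ} (hψR : tsupport ψ ⊆ sectorR) (Λ : ℝ → Finset HexVertex) (x : ℝ → Site 2) (α : ℝ)
    {s : ℝ} (hs : 0 < s) :
    smearedG true Λ x α ψ s = smeared Λ x α ψ s := by
  have key : (∑ᶠ e ∈ SAW.hexDomainMidEdges (Λ s),
      ψ ((SAW.hexMidpoint e - triEmbed (x s)) / (s : ℂ)) * twObs₂ (Λ s) (x s) e) =
      ∑ᶠ e ∈ SAW.hexDomainMidEdges (Λ s),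
        ψ ((SAW.hexMidpoint e - triEmbed (x s)) / (s : ℂ)) * twObs (Λ s) (x s) e := by
    refine finsum_mem_congr rfl fun e he => ?_
    by_cases hmem : (SAW.hexMidpoint e - triEmbed (x s)) / (s : ℂ) ∈ tsupport ψ
    · rw [((hG _ _ _ he).2 (mem_sectorR_of_div hs (hψR hmem)))]
    · rw [image_eq_zero_of_notMem_tsupport hmem]
      simp
  unfold smearedG smeared
  rw [twObsG_true, key]

/-- **The composition in the delta/zeta-reduced form** (no `sorry`). See the module docstring. -/
theorem twistedPropagatorLaw'_of (hT : Tight) (hK : Compact) (hH : Holomorphic) (hG : Gauge)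
    (hL : Liouville) (hA : Amplitude) : TwistedPropagatorLaw' := by
  obtain ⟨α, hα, hT1, ⟨M, hT2⟩, ⟨m, hm, ψ₀, hψ₀, hT3⟩⟩ := hT
  obtain ⟨u, hu4, hGe⟩ := hG
  -- IDENT: along every admissible exhaustion, every sequence of scales `→ ∞` has a subsequence along
  -- which the smeared observable converges to `C · profileIntegral α` on all test functions, some `C`.
  have ident : ∀ (Λ : ℝ → Finset HexVertex) (x : ℝ → Site 2) (ns : ℕ → ℝ), IsPlaneExhaustion Λ x →
      Tendsto ns atTop atTop → ∃ ms : ℕ → ℕ, StrictMono ms ∧ ∃ C : ℂ, ∀ ψ : ℂ → ℂ, TestFn ψ →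
        Tendsto (fun k => smeared Λ x α ψ (ns (ms k))) atTop (𝓝 (C * profileIntegral α ψ)) := by
    intro Λ x ns hadm hns
    -- (1) tightness ⇒ bounded sequences, in both gauges, along any sequence of scales → ∞
    have hb : ∀ (τ : Bool) (ns' : ℕ → ℝ), Tendsto ns' atTop atTop → ∀ ψ : ℂ → ℂ, TestFn ψ →
        ∃ B : ℝ, ∀ k, ‖smearedG τ Λ x α ψ (ns' k)‖ ≤ B := by
      intro τ ns' hns' ψ hψ
      obtain ⟨B, hB⟩ := hT1 τ Λ x ψ hadm hψ
      exact exists_bound_of_eventually (hns'.eventually hB)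
    -- (2) compactness: a subsequence for gauge 1, a further one for gauge 2
    obtain ⟨ms₁, hms₁, Φ₁, hΦ₁⟩ := hK false α Λ x ns hadm hns (hb false ns hns)
    have hns₁ : Tendsto (ns ∘ ms₁) atTop atTop := hns.comp hms₁.tendsto_atTop
    obtain ⟨ms₂, hms₂, Φ₂, hΦ₂⟩ := hK true α Λ x (ns ∘ ms₁) hadm hns₁ (hb true (ns ∘ ms₁) hns₁)
    have hns₂ : Tendsto (ns ∘ ms₁ ∘ ms₂) atTop atTop := hns₁.comp hms₂.tendsto_atTop
    have hΦ₁' : ∀ ψ : ℂ → ℂ, TestFn ψ →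
        Tendsto (fun k => smearedG false Λ x α ψ ((ns ∘ ms₁ ∘ ms₂) k)) atTop (𝓝 (Φ₁ ψ)) :=
      fun ψ hψ => (hΦ₁ ψ hψ).comp hms₂.tendsto_atTop
    have hΦ₂' : ∀ ψ : ℂ → ℂ, TestFn ψ →
        Tendsto (fun k => smearedG true Λ x α ψ ((ns ∘ ms₁ ∘ ms₂) k)) atTop (𝓝 (Φ₂ ψ)) :=
      fun ψ hψ => hΦ₂ ψ hψ
    -- (3) densities, holomorphic off the respective cuts
    obtain ⟨f, hf, hfi, hfΦ⟩ := hH false α hα Λ x (ns ∘ ms₁ ∘ ms₂) Φ₁ hadm hns₂ hΦ₁'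
    obtain ⟨g, hg, hgi, hgΦ⟩ := hH true α hα Λ x (ns ∘ ms₁ ∘ ms₂) Φ₂ hadm hns₂ hΦ₂'
    have hpos : ∀ᶠ k in atTop, 0 < (ns ∘ ms₁ ∘ ms₂) k := hns₂.eventually (eventually_gt_atTop 0)
    -- (4) the exact gauge identities pass to the limit
    have hgS : ∀ ψ : ℂ → ℂ, TestFn ψ → tsupport ψ ⊆ sectorS → ∫ w, ψ w * g w = u * ∫ w, ψ w * f w := by
      intro ψ hψ hS
      rw [← hgΦ ψ hψ, ← hfΦ ψ hψ]
      refine tendsto_nhds_unique (hΦ₂' ψ hψ) (((hΦ₁' ψ hψ).const_mul u).congr' ?_)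
      filter_upwards [hpos] with k hk
      rw [smearedG_false]
      exact (smearedG_true_of_sectorS hGe hS Λ x α hk).symm
    have hgR : ∀ ψ : ℂ → ℂ, TestFn ψ → tsupport ψ ⊆ sectorR → ∫ w, ψ w * g w = ∫ w, ψ w * f w := by
      intro ψ hψ hR
      rw [← hgΦ ψ hψ, ← hfΦ ψ hψ]
      refine tendsto_nhds_unique (hΦ₂' ψ hψ) ((hΦ₁' ψ hψ).congr' ?_)
      filter_upwards [hpos] with k hk
      rw [smearedG_false]
      exact (smearedG_true_of_sectorR hGe hR Λ x α hk).symm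
    -- (5) scale-invariant bounds for `f` from the UNIFORM tightness constant and exact rescaling
    have hbound : ∃ M' : ℝ, ∀ c : ℝ, 0 < c → ∀ φ : ℂ → ℂ, TestFn φ → tsupport φ ⊆ annulusA →
        (∀ w, ‖φ w‖ ≤ 1) → ‖∫ w, φ ((c : ℂ) * w) * f w‖ ≤ M' * c ^ (α - 2) := by
      refine ⟨M, fun c hc φ hφ hφA hφ1 => ?_⟩
      have hφc : TestFn (fun w => φ ((c : ℂ) * w)) := hφ.dilate hc
      have hlim := hΦ₁' _ hφc
      have hadmc : IsPlaneExhaustion (fun s => Λ (c * s)) (fun s => x (c * s)) := hadm.rescale hc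
      have hev : ∀ᶠ s : ℝ in atTop, ‖smeared (fun s => Λ (c * s)) (fun s => x (c * s)) α φ s‖ ≤ M :=
        hT2 _ _ φ hadmc hφ hφA hφ1
      have hsk : Tendsto (fun k => (ns ∘ ms₁ ∘ ms₂) k / c) atTop atTop := hns₂.atTop_div_const hc
      have hskpos : ∀ᶠ k in atTop, 0 < (ns ∘ ms₁ ∘ ms₂) k / c := hsk.eventually (eventually_gt_atTop 0)
      have hev' : ∀ᶠ k in atTop,
          ‖smearedG false Λ x α (fun w => φ ((c : ℂ) * w)) ((ns ∘ ms₁ ∘ ms₂) k)‖ ≤ M * c ^ (α - 2) := by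
        filter_upwards [hsk.eventually hev, hskpos] with k hk hkpos
        have heq : (ns ∘ ms₁ ∘ ms₂) k = c * ((ns ∘ ms₁ ∘ ms₂) k / c) := by field_simp
        rw [smearedG_false, heq, smeared_rescale Λ x α φ hc hkpos, norm_mul,
          Complex.norm_cpow_eq_rpow_re_of_pos hc]
        have hre : ((α : ℂ) - 2).re = α - 2 := by simp
        rw [hre]
        exact (mul_le_mul_of_nonneg_left hk (Real.rpow_nonneg hc.le _)).trans_eq (mul_comm _ _)
      have hle : ‖Φ₁ (fun w => φ ((c : ℂ) * w))‖ ≤ M * c ^ (α - 2) := le_of_tendsto hlim.norm hev'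
      rw [hfΦ _ hφc] at hle
      simpa using hle
    -- (6) Liouville rigidity: `Φ₁ = C · profileIntegral α`
    obtain ⟨C, hC⟩ := hL α hα f g u hu4 hf hfi hg hgi hgS hgR hbound
    refine ⟨ms₁ ∘ ms₂, hms₁.comp hms₂, C, fun ψ hψ => ?_⟩
    have h := hΦ₁' ψ hψ
    rw [hfΦ ψ hψ, hC ψ hψ] at h
    simpa [smearedG_false, Function.comp] using h
  -- Vacuity split: without an admissible exhaustion the crux is vacuous.
  by_cases hex : ∃ (Λ : ℝ → Finset HexVertex) (x : ℝ → Site 2), IsPlaneExhaustion Λ x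
  · obtain ⟨Λ₀, x₀, hadm₀⟩ := hex
    -- reference amplitude along integer scales of the reference exhaustion
    obtain ⟨ms₀, hms₀, Cstar, hC₀⟩ :=
      ident Λ₀ x₀ (fun n : ℕ => (n : ℝ)) hadm₀ tendsto_natCast_atTop_atTop
    have hns₀ : Tendsto ((fun n : ℕ => (n : ℝ)) ∘ ms₀) atTop atTop :=
      tendsto_natCast_atTop_atTop.comp hms₀.tendsto_atTop
    -- non-degeneracy
    have hCne : Cstar ≠ 0 := by
      intro h0
      have hlim := hC₀ ψ₀ hψ₀
      rw [h0, zero_mul] at hlim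
      have hev : ∀ᶠ k in atTop, m ≤ ‖smeared Λ₀ x₀ α ψ₀ (((fun n : ℕ => (n : ℝ)) ∘ ms₀) k)‖ :=
        hns₀.eventually (hT3 Λ₀ x₀ hadm₀)
      have hle : m ≤ ‖(0 : ℂ)‖ := ge_of_tendsto hlim.norm hev
      rw [norm_zero] at hle
      exact absurd hle (not_le.2 hm)
    refine ⟨α, Cstar, hα, hCne, ?_⟩
    intro Λ x ψ hsc hKc hψc hψs hψ0
    have hadm : IsPlaneExhaustion Λ x := ⟨hsc, hKc⟩
    have hψ : TestFn ψ := ⟨hψc, hψs, hψ0⟩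
    refine Filter.tendsto_of_subseq_tendsto fun ns hns => ?_
    obtain ⟨ms, hms, C, hC⟩ := ident Λ x ns hadm hns
    have hCC : C = Cstar :=
      hA α hα Λ x Λ₀ x₀ (ns ∘ ms) ((fun n : ℕ => (n : ℝ)) ∘ ms₀) C Cstar hadm hadm₀
        (hns.comp hms.tendsto_atTop) hns₀ (fun ψ hψ => hC ψ hψ) (fun ψ hψ => hC₀ ψ hψ)
    exact ⟨ms, by simpa [hCC] using hC ψ hψ⟩
  · refine ⟨α, 1, hα, one_ne_zero, ?_⟩
    intro Λ x ψ hsc hKc _ _ _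
    exact absurd ⟨Λ, x, ⟨hsc, hKc⟩⟩ hex

/-! ### 5. The skeleton theorem: the six stubs imply the crux, BY NAME -/

/-- **`TwistedPropagatorLaw` from the line `gauge-liouville`** (kernel-checked, no `sorry` of its own):
hypotheses = the six stubs under their registered names; conclusion = the route decl, by name. -/
theorem TwistedPropagatorLaw_of (hT : __Registered.stub_tight) (hK : __Registered.stub_compact)
    (hH : __Registered.stub_holomorphic) (hG : __Registered.stub_gauge)
    (hL : __Registered.stub_liouville) (hA : __Registered.stub_amplitude) :
    Summit.CriticalPhenomena.SAWScalingLimit.Theses.SAWQuarterTwist.TwistedPropagatorLaw :=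
  twistedPropagatorLaw_iff.mp (twistedPropagatorLaw'_of hT hK hH hG hL hA)

/-- Wiring check: the registered stubs, with their stated types, feed the skeleton theorem. -/
example : Summit.CriticalPhenomena.SAWScalingLimit.Theses.SAWQuarterTwist.TwistedPropagatorLaw :=
  TwistedPropagatorLaw_of stub_tight stub_compact stub_holomorphic stub_gauge stub_liouville
    stub_amplitude

end Summit.CriticalPhenomena.SAWScalingLimit.Cruxes.TwistedPropagatorLaw.GaugeLiouville

end
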